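import Summits.QuantumFields.BalabanUV.Beta.D1BFx.NeedlePotentialLetters
import Summits.QuantumFields.BalabanUV.Beta.D1BFx.RColumnProfile

/-!
# `BalabanUV.Beta.D1BFx.NeedlePotentialProfile` — road «BF-x» for binder row D1, slot (K), END row `hGrp gN`, «GN-L3» PART 2f (owner ruling ρ-g9-33 (L3)):
# THE NEEDLE POTENTIAL AS A NEEDLE-WEIGHTED SUM OF COULOMB PROFILES — `|ndlRow n a κ′ u x| ≤ Σ_{s∈B(blk u)} |qJet_u s|·(kV∕n²·e^{−(dR∕2∕n)‖x−s‖∞}∕nrm(x−s)²)`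
# and its x-gradient twin (`kP`, `nrm⁻³`) — the thin-needle (κ′ ≤ 2) input of an3 §3′ (2)'s profile `Φ_u`

HONEST DEPENDENCY (cell records, verbatim): «continuum YM on T⁴ ⇐ BetaPertH ∧ nine spine estimates (0/9 proved); BetaPertH ⇐ (D1) ∧ (D4) ∧
CAP+tail; G-an2-4 gates asym, D1 and NE2/3/4.»  HONEST FRAMING (cell contract, verbatim): «discharging `BetaPertH` makes Bałaban's UV stability
UNCONDITIONAL — a real constructive-QFT result; it is NOT the continuum limit and NOT the Clay problem.»  THIS MODULE DISCHARGES NOTHING of the wall: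
[folklore] termwise bookkeeping over PART 2d `RColumnProfile.abs_RG_le_profile`∕`abs_RG_diff_le_profile` inside PART 2c's `ndlRow`; no `def`, no `def … : Prop`,
no hypothesis is a printed statement, 0 binders of row D1 touched; (K) NOT closed; NOT (CONV-C), NOT D1, NOT BetaPertH, NOT continuum, NOT Clay.

WHY (an3-g57 §3′ (2) «profile `|row_u(x)| ≤ k·n⁻⁶·Σ_{s∈𝒩_u} nrm(x−s)⁻²e^{…} + k·w_u·n⁻⁴` … `Φ_u(x) := Σ_{x′}|∇Ga(x,x′)|·|row_u(x′)| ≤ k·n⁻⁶·Σ_{s∈𝒩_u} nrm(x−s)⁻¹`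
(λ ≥ 1) … The profiles `Φ_u` are needed only for the THIN needles κ ≤ 2, where sup × support overcounts the near-sheet region»).  PART 2c's sup letter
`abs_ndlRow_le` roofs the needle by its block (`n⁻⁴·cR`); here the needle weight `|qJet_u s|` (`= n⁻⁴` on the needle box `𝒩_u`, `0` off it) is kept against the
R-column's Coulomb profile centred at each needle site `s` (the smooth `Pgt∘Ggh` part already absorbed into `kV`∕`kP` by PART 2d), so that a consumer obtains
`Φ_u` by ONE kernel∘profile step per needle site (`LatticeHLSProfiles.abs_tsum_mul_le_of_profiles` at (3,2): `Σ_{x′}|∇Ga(x,x′)|∕nrm(x′−s)² ≤ κ·C∕nrm(x−s)`)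
followed by the needle census (`AveragingJetNeedle.card_needle_le`).
CONTENT ([folklore]; `[NeZero n]`, `0 < a`): **`abs_ndlRow_le_needle_profile`**, **`abs_ndlRow_diff_le_needle_profile`**, and the undamped forms
**`abs_ndlRow_le_needle_inv_sq`**, **`abs_ndlRow_diff_le_needle_inv_cube`**.  NOT HERE: `Φ_u` itself (needs the vector leg's d1 row, h12∕h126 class); any END row.
Unit `b2b-balaban-gan24-formalise-leaf-05` (gen 41), G-an2-4 swarm leaf prover on cross-lane kernel duty; `LEAVES-BFx.md` row (N) «GN-L3» PART 2f.
-/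

namespace Summit.QuantumFields.BalabanUV.Beta.D1BFx.NeedlePotentialProfile

open Finset
open scoped BigOperators
open Literature.MathematicalPhysics.QuantumFieldTheory.Balaban1983to89
open Literature.MathematicalPhysics.QuantumFieldTheory.Balaban1983to89.Beta
open B6QGQLower276 (X blk B)
open Beta.PoissonInterior (nrm)
open AffineAveraging (unitVec)
open Summit.QuantumFields.BalabanUV.Beta.D1BFx.RProjector (Pgt)
open Summit.QuantumFields.BalabanUV.Beta.D1BFx.GhostLeg (Ggh)
open Summit.QuantumFields.BalabanUV.Beta.D1BFx.GhostStencil (qJet)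
open Summit.QuantumFields.BalabanUV.Beta.D1BFx.RProjectorJet (RG)
open Summit.QuantumFields.BalabanUV.Beta.D1BFx.RColumnBlockMass (dR)
open Summit.QuantumFields.BalabanUV.Beta.D1BFx.NeedlePotentialLetters (ndlRow ndlRow_def ndlRow_diff_eq)
open Summit.QuantumFields.BalabanUV.Beta.D1BFx.RColumnProfile (kV kP abs_RG_le_profile abs_RG_diff_le_profile abs_RG_le_inv_sq abs_RG_diff_le_inv_cube)

noncomputable section

variable (n : ℕ) [NeZero n] {a : ℝ} (κ' : Fin 4) (u : X 4)

omit [NeZero n] in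
/-- [folklore] The termwise step: `|Σ_{s∈B(blk u)} A s·qJet s| ≤ Σ_{s∈B(blk u)} |qJet s|·φ s` whenever `|A s| ≤ φ s` on the block. -/
theorem abs_sum_mul_qJet_le_sum {A φ : X 4 → ℝ} (h : ∀ s ∈ B (n - 1) (blk (n - 1) u), |A s| ≤ φ s) :
    |∑ s ∈ B (n - 1) (blk (n - 1) u), A s * qJet n κ' u (blk (n - 1) u) s|
      ≤ ∑ s ∈ B (n - 1) (blk (n - 1) u), |qJet n κ' u (blk (n - 1) u) s| * φ s :=
  (Finset.abs_sum_le_sum_abs _ _).trans (Finset.sum_le_sum fun s hs => by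
    rw [abs_mul, mul_comm]; exact mul_le_mul_of_nonneg_left (h s hs) (abs_nonneg _))

/-- [folklore] **THE NEEDLE POTENTIAL AS A NEEDLE-WEIGHTED SUM OF DAMPED COULOMB PROFILES**:
`|ndlRow n a κ′ u x| ≤ Σ_{s∈B(blk u)} |qJet_u s| · (kV a∕n² · e^{−(dR a∕2∕n)‖x−s‖∞} ∕ nrm(x−s)²)`. -/
theorem abs_ndlRow_le_needle_profile (ha : 0 < a) (x : X 4) :
    |ndlRow n a κ' u x| ≤ ∑ s ∈ B (n - 1) (blk (n - 1) u), |qJet n κ' u (blk (n - 1) u) s|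
      * (kV a / (n : ℝ) ^ 2 * Real.exp (-(dR a / 2 / n) * Beta.PoissonInterior.supNorm (x - s)) / nrm (x - s) ^ 2) := by
  rw [ndlRow_def]
  exact abs_sum_mul_qJet_le_sum n κ' u fun s _ => abs_RG_le_profile n ha x s

/-- [folklore] **THE x-GRADIENT OF THE NEEDLE POTENTIAL AS A NEEDLE-WEIGHTED SUM OF DAMPED COULOMB PROFILES**:
`|ndlRow (x+e_ρ) − ndlRow x| ≤ Σ_{s∈B(blk u)} |qJet_u s| · (kP a∕n² · e^{−(dR a∕2∕n)‖x−s‖∞} ∕ nrm(x−s)³)`. -/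
theorem abs_ndlRow_diff_le_needle_profile (ha : 0 < a) (x : X 4) (ρ : Fin 4) :
    |ndlRow n a κ' u (x + unitVec ρ) - ndlRow n a κ' u x| ≤ ∑ s ∈ B (n - 1) (blk (n - 1) u), |qJet n κ' u (blk (n - 1) u) s|
      * (kP a / (n : ℝ) ^ 2 * Real.exp (-(dR a / 2 / n) * Beta.PoissonInterior.supNorm (x - s)) / nrm (x - s) ^ 3) := by
  rw [ndlRow_diff_eq]
  exact abs_sum_mul_qJet_le_sum n κ' u fun s _ => abs_RG_diff_le_profile n ha x s ρ

/-- [folklore] Undamped form: `|ndlRow n a κ′ u x| ≤ Σ_{s∈B(blk u)} |qJet_u s| · ((kV a∕n²) ∕ nrm(x−s)²)`. -/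
theorem abs_ndlRow_le_needle_inv_sq (ha : 0 < a) (x : X 4) :
    |ndlRow n a κ' u x| ≤ ∑ s ∈ B (n - 1) (blk (n - 1) u), |qJet n κ' u (blk (n - 1) u) s| * (kV a / (n : ℝ) ^ 2 / nrm (x - s) ^ 2) := by
  rw [ndlRow_def]
  exact abs_sum_mul_qJet_le_sum n κ' u fun s _ => abs_RG_le_inv_sq n ha x s

/-- [folklore] Undamped form: `|ndlRow (x+e_ρ) − ndlRow x| ≤ Σ_{s∈B(blk u)} |qJet_u s| · ((kP a∕n²) ∕ nrm(x−s)³)`. -/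
theorem abs_ndlRow_diff_le_needle_inv_cube (ha : 0 < a) (x : X 4) (ρ : Fin 4) :
    |ndlRow n a κ' u (x + unitVec ρ) - ndlRow n a κ' u x|
      ≤ ∑ s ∈ B (n - 1) (blk (n - 1) u), |qJet n κ' u (blk (n - 1) u) s| * (kP a / (n : ℝ) ^ 2 / nrm (x - s) ^ 3) := by
  rw [ndlRow_diff_eq]
  exact abs_sum_mul_qJet_le_sum n κ' u fun s _ => abs_RG_diff_le_inv_cube n ha x s ρ

end

end Summit.QuantumFields.BalabanUV.Beta.D1BFx.NeedlePotentialProfile
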